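import Summits.QuantumFields.YangMills.Theorems.BalabanUVNodesK0RecordFormatNamesP0CGuardedL
import Summits.QuantumFields.YangMills.Theorems.BalabanUVNodesK0RecordFormatNamesLemmas17
import Summits.QuantumFields.YangMills.Theorems.BalabanUVNodesPortS1G3CCollect

/-!
# NODE O port — `stub_P0C` (the guarded P0-ℂ letter `P0HolExtAtRecordGL`), brick A: THE MÖBIUS SUPPLIER INTERFACE
# (memo `Cruxes/PortRecordRepresentationS1/Lines/pta_residueW-stub_P0C-hand.md` §3 R7)

Porter hand `hand-27930-P0C` (g0), `--supports stmt-QuantumFields-27930 --as helper`; count-neutral.  [I] = [Balaban1987RG1], [B9] = [Balaban1985BackgroundPropagators],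
[16] = [Balaban1985UV3].

WHY.  Clauses (P4-a) `TC = Σ_Y TY` and (P5ᶜ) (coercivity of `Σ_{Y ⊆ X} TY` for EVERY `X ∈ 𝐃`) of `K0RecordFormatNames.P0CarrierClauses` force the piece family `TY` of
`stub_P0C`'s carrier to have PRESCRIBED PARTIAL SUMS `X ↦ T_X := Σ_{Y ⊆ X} TY` (an X-local coercive operator for every localization domain `X`; [I] (1.7) p.261, [16] (23)
p.262: print DEFINES the X-localized operators first, by boundary conditions on `X`).  Conversely, over the finite poset `(𝐃, ⊆)` every family `X ↦ T_X` has EXACTLY ONE piece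
family with these partial sums — its Möbius inverse `TY := T_Y − Σ_{Y′ ⊊ Y} TY′` — and support ∕ (1.7)-locality ∕ analyticity-on-the-record-space ∕ (1.10)-covariance pass from the
family to the pieces by linearity along MONOTONE families of properties.  So the supplier's real object is `X ↦ T_X` (the X-localized holomorphic (2.11) operator, [I] p.267–268,
[B9] §A–§B), and the only clause that does NOT transfer is DECAY of the Möbius pieces ([16] (23)–(25), [B9] Cor. 3.8 (3.94)) — the genuine estimate.  Print's walk-resummed pieces
satisfy the partial-sum identities, hence ARE the Möbius pieces (`mobius_unique`).

WHAT THIS FILE PROVES (sorry-free; generic part `P0CMob.*` over ANY index type with a strict-down-set enumerator — so it serves the torus catalogue `𝐃_{k+1}(T_K)` (`Fintype`)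
and the integer windows `Finset (Fin 4 → ℤ)` (`Finset.ssubsets`) alike):
* `P0CMob.DownSets.mobius` (well-founded recursion on `#(val Y)`), `mobius_eq`, ★ `sum_mobius_subsets` (`Σ_{Y ⊆ X} μT Y = T X`), ★ `mobius_unique`, ★ `mobius_induction` (closure of
  predicates monotone along `⊂` and closed under `0, +, −`), `mobius_add`, `mobius_zero`.
* record instances (`K0RecordFormatNames` currency, fixed `Mc k K`): `p0cPiece`, ★ `sum_p0cPiece_subset` (= the inner sum of (P5ᶜ) VERBATIM), ★ `sum_p0cPiece_univ` ((P4-a) at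
  `X_full = g3cFull`), `p0cPiece_support` (P4-b), `p0cPiece_local` (P4-c), `p0cPiece_analyticAt` (P4-d, via ✓`recordUc_antitone`), `p0cPiece_cAct` (P3), `p0cPiece_unique`.

HONEST FRAMING.  Finite Möbius inversion + bookkeeping at the record's names; NO estimate; nothing of Bałaban asserted, ported or discharged; `stub_P0C` NOT closed (its rows
(M2)(M3)(M4) of the memo — uniform analyticity radii, decay, (E2) coercivity — are inhabited nowhere); ⟨27930⟩ OPEN; NODE O 0∕1; COUNT 8∕28 · K 1∕4 UNMOVED; finite `𝕋⁴_{L^K}` at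
fixed ε — NOT continuum ∕ OS ∕ Clay; **the Yang–Mills mass gap is NOT proved by any of this.**  No `sorry`, no `instance`, no `notation`; standard axioms.
-/

noncomputable section

open scoped BigOperators Matrix.Norms.L2Operator Topology
open Finset

namespace Summit.QuantumFields.YangMills.Theorems.BalabanUVNodesPortS1

/-! ## §1  Generic Möbius inversion over a family injected into finite sets -/

namespace P0CMob

variable {D : Type*} {α : Type*}

/-- **A strict-down-set enumerator** for a family `val : D → Finset α`: `below Y` lists exactly the members `Y′` with `val Y′ ⊂ val Y`
(for a `Fintype` it is `univ.filter`, for `D = Finset α` it is `Finset.ssubsets`). [folklore] -/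
structure DownSets (val : D → Finset α) where
  /-- the enumerator of the strict down-set -/
  below : D → Finset D
  /-- specification: membership is strict inclusion of the underlying sets -/
  mem_below_iff : ∀ Y Y', Y' ∈ below Y ↔ val Y' ⊂ val Y

namespace DownSets

variable {val : D → Finset α} (𝔅 : DownSets val) {M : Type*} [AddCommGroup M]

/-- **The Möbius pieces** of a family `T : D → M`: `μT Y := T Y − Σ_{Y′ : val Y′ ⊂ val Y} μT Y′` (well-founded recursion on `#(val Y)`).
[cite: Balaban1987RG1, (1.7) p.261 (the localized representation)] -/
def mobius (T : D → M) (Y : D) : M :=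
  T Y - ∑ Y' ∈ (𝔅.below Y).attach,
    have : (val Y'.1).card < (val Y).card := Finset.card_lt_card ((𝔅.mem_below_iff Y Y'.1).1 Y'.2)
    mobius T Y'.1
termination_by (val Y).card

/-- The defining equation of the Möbius pieces. [folklore] -/
theorem mobius_eq (T : D → M) (Y : D) : mobius 𝔅 T Y = T Y - ∑ Y' ∈ 𝔅.below Y, mobius 𝔅 T Y' := by
  rw [mobius]
  congr 1
  exact Finset.sum_attach (𝔅.below Y) (fun Y' => mobius 𝔅 T Y')

/-- The weak down-set `{Y′ : val Y′ ⊆ val X}` enumerated as `insert X (below X)` — valid when `val` is injective. [folklore] -/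
def belowEq (X : D) : Finset D := by
  classical
  exact insert X (𝔅.below X)

/-- Membership in the weak down-set is weak inclusion (for injective `val`). [folklore] -/
theorem mem_belowEq_iff (hinj : Function.Injective val) (X Y : D) : Y ∈ 𝔅.belowEq X ↔ val Y ⊆ val X := by
  classical
  unfold belowEq
  rw [Finset.mem_insert, 𝔅.mem_below_iff]
  constructor
  · rintro (rfl | h)
    · exact Finset.Subset.refl _
    · exact h.subset
  · intro h
    by_cases he : val Y = val X
    · exact Or.inl (hinj he)
    · exact Or.inr (Finset.ssubset_iff_subset_ne.2 ⟨h, he⟩)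

/-- `X` is not strictly below itself. [folklore] -/
theorem not_mem_below_self (X : D) : X ∉ 𝔅.below X := fun h =>
  (Finset.ssubset_iff_subset_ne.1 ((𝔅.mem_below_iff X X).1 h)).2 rfl

/-- ★ **THE PARTIAL-SUM IDENTITY**: `Σ_{Y : val Y ⊆ val X} μT Y = T X` (one unfolding of the recursion; `val` injective).
[cite: Balaban1987RG1, (1.7) p.261; Balaban1985UV3, (23) p.262] -/
theorem sum_mobius_belowEq (T : D → M) (X : D) :
    ∑ Y ∈ 𝔅.belowEq X, mobius 𝔅 T Y = T X := by
  classical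
  unfold belowEq
  rw [Finset.sum_insert (𝔅.not_mem_below_self X), mobius_eq]
  abel

/-- The same over ANY finite set that enumerates the weak down-set. [folklore] -/
theorem sum_mobius_of_mem_iff (hinj : Function.Injective val) (T : D → M) (X : D) {s : Finset D} (hs : ∀ Y, Y ∈ s ↔ val Y ⊆ val X) :
    ∑ Y ∈ s, mobius 𝔅 T Y = T X := by
  have : s = 𝔅.belowEq X := by
    ext Y; rw [hs, 𝔅.mem_belowEq_iff hinj]
  rw [this]
  exact 𝔅.sum_mobius_belowEq T X

/-- ★ **UNIQUENESS**: any piece family with the same partial sums IS the Möbius inverse (so print's walk-resummed pieces are these pieces).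
[cite: Balaban1985BackgroundPropagators, Cor. 3.8 p.410 (walk terms localized in □₀ ∪ … ∪ □ₙ)] -/
theorem mobius_unique {T E : D → M} (h : ∀ X, ∑ Y ∈ 𝔅.belowEq X, E Y = T X) : E = mobius 𝔅 T := by
  classical
  funext X
  induction hn : (val X).card using Nat.strong_induction_on generalizing X with
  | _ n ih =>
    have hX := h X
    unfold belowEq at hX
    rw [Finset.sum_insert (𝔅.not_mem_below_self X)] at hX
    rw [mobius_eq, ← hX]
    have hs : ∑ Y ∈ 𝔅.below X, E Y = ∑ Y ∈ 𝔅.below X, mobius 𝔅 T Y := by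
      refine Finset.sum_congr rfl fun Y hY => ?_
      have hlt : (val Y).card < (val X).card := Finset.card_lt_card ((𝔅.mem_below_iff X Y).1 hY)
      exact ih (val Y).card (hn ▸ hlt) Y rfl
    rw [hs]
    abel

/-- ★ **TRANSFER along monotone predicate families**: a property `p Y` of `M`-values that passes from `Y′` to `Y` when `val Y′ ⊂ val Y` and is closed under `0`, `+`, `−`
holds for every Möbius piece as soon as it holds for every member of the family. [folklore] -/
theorem mobius_induction (p : D → M → Prop) (hmono : ∀ Y Y' m, val Y' ⊂ val Y → p Y' m → p Y m) (h0 : ∀ Y, p Y 0)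
    (hadd : ∀ Y a b, p Y a → p Y b → p Y (a + b)) (hsub : ∀ Y a b, p Y a → p Y b → p Y (a - b)) {T : D → M} (hT : ∀ Y, p Y (T Y)) :
    ∀ Y, p Y (mobius 𝔅 T Y) := by
  intro Y
  induction hn : (val Y).card using Nat.strong_induction_on generalizing Y with
  | _ n ih =>
    rw [mobius_eq]
    refine hsub Y _ _ (hT Y) ?_
    refine Finset.sum_induction _ (p Y) (fun a b ha hb => hadd Y a b ha hb) (h0 Y) ?_
    intro Y' hY'
    have hss : val Y' ⊂ val Y := (𝔅.mem_below_iff Y Y').1 hY'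
    exact hmono Y Y' _ hss (ih (val Y').card (hn ▸ Finset.card_lt_card hss) Y' rfl)

/-- The Möbius pieces of the zero family vanish. [folklore] -/
theorem mobius_zero : mobius 𝔅 (0 : D → M) = 0 := by
  funext Y
  have := 𝔅.mobius_induction (fun _ m => m = 0) (fun _ _ _ _ h => h) (fun _ => rfl) (fun _ a b ha hb => by rw [ha, hb, add_zero])
    (fun _ a b ha hb => by rw [ha, hb, sub_zero]) (T := (0 : D → M)) (fun _ => rfl) Y
  simpa using this

/-- Möbius inversion is additive in the family (uniqueness). [folklore] -/
theorem mobius_add (T S : D → M) : mobius 𝔅 (T + S) = mobius 𝔅 T + mobius 𝔅 S := by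
  symm
  refine 𝔅.mobius_unique fun X => ?_
  rw [Pi.add_apply, ← 𝔅.sum_mobius_belowEq T X, ← 𝔅.sum_mobius_belowEq S X, ← Finset.sum_add_distrib]
  rfl

end DownSets

/-- The `Fintype` enumerator: `below Y := univ.filter (val · ⊂ val Y)`. [folklore] -/
def downSetsOfFintype [Fintype D] (val : D → Finset α) : DownSets val := by
  classical
  exact ⟨fun Y => Finset.univ.filter fun Y' => val Y' ⊂ val Y, fun _ _ => by simp⟩

/-- The `Finset` enumerator (integer windows): `below Y := Y.ssubsets`, `val := id`. [folklore] -/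
def downSetsFinset [DecidableEq α] : DownSets (id : Finset α → Finset α) :=
  ⟨fun Y => Y.ssubsets, fun _ _ => Finset.mem_ssubsets⟩

end P0CMob

/-! ## §2  The record instances (fixed catalogue `𝐃_{k+1}(T_K)`, `K0RecordFormatNames` currency) -/

section Record

open Summit.QuantumFields.YangMills.Theorems.K0RecordFormatNames
open Literature.MathematicalPhysics.QuantumFieldTheory.Balaban1983to89
open Literature.MathematicalPhysics.QuantumFieldTheory.Balaban1983to89.Node00
open Literature.MathematicalPhysics.QuantumFieldTheory.Balaban1983to89.T4Continuum (T4Family)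
open Literature.MathematicalPhysics.QuantumFieldTheory.Balaban1983to89.TreeLengthTorus (TPt)

variable (F : T4Family)

/-- The cube family of a localization domain (`Subtype.val`, displayed with its type). [cite: Balaban1987RG1, p.257 (localization domains)] -/
def p0cCubes (Mc k K : ℕ) (Y : (recordDomSys F Mc k K).Dom) : Finset (TPt (F.P K).d (Sect2.domCount (F.P K) Mc (k + 1))) := Y.1

/-- `p0cCubes` is injective (domains are determined by their cubes). [folklore] -/
theorem p0cCubes_injective (Mc k K : ℕ) : Function.Injective (p0cCubes F Mc k K) :=
  fun _ _ h => Subtype.ext h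

/-- The strict-down-set enumerator of the record's catalogue. [folklore] -/
def p0cDown (Mc k K : ℕ) : P0CMob.DownSets (p0cCubes F Mc k K) :=
  P0CMob.downSetsOfFintype (p0cCubes F Mc k K)

/-- **THE PIECES OF AN X-INDEXED FAMILY OF LOCALIZED KERNELS** — `p0cPiece F Mc k K T Y := T_Y − Σ_{Y′ ⊊ Y} (pieces)`, the Möbius inverse over `(𝐃_{k+1}(T_K), ⊆)` of a family
`T : 𝐃 → (pairs (𝐔,𝐉) → level-k bond kernels)`; the candidate `TY n` of `P0CarrierClauses` when `T = (X ↦ the X-localized (2.11) operator)`.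
[cite: Balaban1987RG1, (1.7) p.261, (2.11) p.267; Balaban1985UV3, (23) p.262] -/
def p0cPiece (Mc k K : ℕ) (T : (recordDomSys F Mc k K).Dom → Sect2.CPair (F.P K) (MatA 2) → FluctIdx F k K → FluctIdx F k K → ℂ) :
    (recordDomSys F Mc k K).Dom → Sect2.CPair (F.P K) (MatA 2) → FluctIdx F k K → FluctIdx F k K → ℂ :=
  (p0cDown F Mc k K).mobius T

variable {F}
variable {Mc k K : ℕ} (T : (recordDomSys F Mc k K).Dom → Sect2.CPair (F.P K) (MatA 2) → FluctIdx F k K → FluctIdx F k K → ℂ)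

/-- ★ **THE PARTIAL-SUM IDENTITY IN (P5ᶜ)'s LETTERS**: `Σ_{Y ∈ univ.filter (Y.1 ⊆ X.1)} piece T Y φ i j = T X φ i j` — the inner sum of (P5ᶜ) of `P0CarrierClauses` IS the
X-localized kernel. [cite: Balaban1987RG1, (1.7) p.261; Balaban1985Variational, Thm 1 (E2) p.279 (the X-local operator)] -/
theorem sum_p0cPiece_subset (X : (recordDomSys F Mc k K).Dom) (φ : Sect2.CPair (F.P K) (MatA 2)) (i j : FluctIdx F k K) :
    ∑ Y ∈ Finset.univ.filter (fun Y : (recordDomSys F Mc k K).Dom => Y.1 ⊆ X.1), p0cPiece F Mc k K T Y φ i j = T X φ i j := by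
  classical
  have h := (p0cDown F Mc k K).sum_mobius_of_mem_iff (p0cCubes_injective F Mc k K) T X
    (s := Finset.univ.filter (fun Y : (recordDomSys F Mc k K).Dom => Y.1 ⊆ X.1)) (fun Y => by simp [p0cCubes])
  have h' := congrFun (congrFun (congrFun h φ) i) j
  simpa only [p0cPiece, Finset.sum_apply] using h'

/-- ★ **(P4-a) AT THE WHOLE TORUS**: `Σ_{Y : 𝐃} piece T Y φ i j = T X_full φ i j` (`X_full = g3cFull`, ✓`G3CGeom.isTDom_univ'`) — so `TC n := T_n X_full` meets (P4-a) by definition.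
[cite: Balaban1987RG1, (1.7) p.261, p.257 (the torus is the largest domain)] -/
theorem sum_p0cPiece_univ (φ : Sect2.CPair (F.P K) (MatA 2)) (i j : FluctIdx F k K) :
    ∑ Y : (recordDomSys F Mc k K).Dom, p0cPiece F Mc k K T Y φ i j = T (g3cFull F Mc k K) φ i j := by
  classical
  rw [← sum_p0cPiece_subset T (g3cFull F Mc k K) φ i j]
  refine (Finset.sum_subset (Finset.filter_subset _ _) fun Y _ hY => ?_).symm
  exact absurd (Finset.mem_filter.2 ⟨Finset.mem_univ Y, fun c _ => mem_g3cFull F Mc k K c⟩) hY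

/-- **UNIQUENESS at the record**: a piece family with the prescribed partial sums on every domain IS `p0cPiece T`. [cite: Balaban1985BackgroundPropagators, Cor. 3.8 p.410] -/
theorem p0cPiece_unique {E : (recordDomSys F Mc k K).Dom → Sect2.CPair (F.P K) (MatA 2) → FluctIdx F k K → FluctIdx F k K → ℂ}
    (h : ∀ X φ i j, ∑ Y ∈ Finset.univ.filter (fun Y : (recordDomSys F Mc k K).Dom => Y.1 ⊆ X.1), E Y φ i j = T X φ i j) :
    E = p0cPiece F Mc k K T := by
  classical
  refine (p0cDown F Mc k K).mobius_unique fun X => ?_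
  have hs : (p0cDown F Mc k K).belowEq X = Finset.univ.filter (fun Y : (recordDomSys F Mc k K).Dom => Y.1 ⊆ X.1) := by
    ext Y; rw [(p0cDown F Mc k K).mem_belowEq_iff (p0cCubes_injective F Mc k K)]; simp [p0cCubes]
  rw [hs]
  funext φ i j
  rw [Finset.sum_apply, Finset.sum_apply, Finset.sum_apply]
  exact h X φ i j

/-- **(P4-b) TRANSFERS**: if every `T_X` is supported on the level-k bonds sourced in `domSites X` (both indices), so is every piece.
[cite: Balaban1987RG1, (1.7) p.261 («depends on U_j restricted to X»)] -/
theorem p0cPiece_support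
    (hT : ∀ (X : (recordDomSys F Mc k K).Dom) (φ : Sect2.CPair (F.P K) (MatA 2)) (i j : FluctIdx F k K),
      (B15DeterminingSets.embIter k i.1.src ∉ Sect2.domSites (F.P K) Mc (k + 1) X ∨
        B15DeterminingSets.embIter k j.1.src ∉ Sect2.domSites (F.P K) Mc (k + 1) X) → T X φ i j = 0)
    (Y : (recordDomSys F Mc k K).Dom) (φ : Sect2.CPair (F.P K) (MatA 2)) (i j : FluctIdx F k K)
    (hij : B15DeterminingSets.embIter k i.1.src ∉ Sect2.domSites (F.P K) Mc (k + 1) Y ∨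
      B15DeterminingSets.embIter k j.1.src ∉ Sect2.domSites (F.P K) Mc (k + 1) Y) :
    p0cPiece F Mc k K T Y φ i j = 0 := by
  let p : (recordDomSys F Mc k K).Dom → (Sect2.CPair (F.P K) (MatA 2) → FluctIdx F k K → FluctIdx F k K → ℂ) → Prop :=
    fun Y m => ∀ φ i j, (B15DeterminingSets.embIter k i.1.src ∉ Sect2.domSites (F.P K) Mc (k + 1) Y ∨
      B15DeterminingSets.embIter k j.1.src ∉ Sect2.domSites (F.P K) Mc (k + 1) Y) → m φ i j = 0
  have key : ∀ Y, p Y (p0cPiece F Mc k K T Y) := by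
    refine (p0cDown F Mc k K).mobius_induction p ?_ ?_ ?_ ?_ hT
    · intro Y Y' m hss hm φ i j hij
      have hsub := domSites_subset_of_subset (F.P K) Mc (k + 1) (Z := Y') (X := Y) hss.subset
      exact hm φ i j (hij.imp (fun h h' => h (hsub h')) (fun h h' => h (hsub h')))
    · intro Y φ i j _; rfl
    · intro Y a b ha hb φ i j hij; simp only [Pi.add_apply, ha φ i j hij, hb φ i j hij, add_zero]
    · intro Y a b ha hb φ i j hij; simp only [Pi.sub_apply, ha φ i j hij, hb φ i j hij, sub_zero]
  exact key Y φ i j hij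

/-- **(P4-c) TRANSFERS**: if every `T_X` reads the pair only on `domSites X` ((1.7) locality), so does every piece.
[cite: Balaban1987RG1, (1.7) p.261] -/
theorem p0cPiece_local
    (hT : ∀ (X : (recordDomSys F Mc k K).Dom) (φ ψ : Sect2.CPair (F.P K) (MatA 2)),
      Sect2.agreeOnSet (Sect2.domSites (F.P K) Mc (k + 1) X) φ ψ → T X φ = T X ψ)
    (Y : (recordDomSys F Mc k K).Dom) (φ ψ : Sect2.CPair (F.P K) (MatA 2)) (h : Sect2.agreeOnSet (Sect2.domSites (F.P K) Mc (k + 1) Y) φ ψ) :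
    p0cPiece F Mc k K T Y φ = p0cPiece F Mc k K T Y ψ := by
  let p : (recordDomSys F Mc k K).Dom → (Sect2.CPair (F.P K) (MatA 2) → FluctIdx F k K → FluctIdx F k K → ℂ) → Prop :=
    fun Y m => ∀ φ ψ, Sect2.agreeOnSet (Sect2.domSites (F.P K) Mc (k + 1) Y) φ ψ → m φ = m ψ
  have key : ∀ Y, p Y (p0cPiece F Mc k K T Y) := by
    refine (p0cDown F Mc k K).mobius_induction p ?_ ?_ ?_ ?_ hT
    · intro Y Y' m hss hm φ ψ hφψ
      exact hm φ ψ (Sect2.agreeOnSet_mono (domSites_subset_of_subset (F.P K) Mc (k + 1) (Z := Y') (X := Y) hss.subset) hφψ)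
    · intro Y φ ψ _; rfl
    · intro Y a b ha hb φ ψ hφψ; simp only [Pi.add_apply, ha φ ψ hφψ, hb φ ψ hφψ]
    · intro Y a b ha hb φ ψ hφψ; simp only [Pi.sub_apply, ha φ ψ hφψ, hb φ ψ hφψ]
  exact key Y φ ψ h

/-- **(P4-d) TRANSFERS** (by ✓`recordUc_antitone`, consumer check C-2): if every entry of every `T_X` is analytic at the points of the record space of `X`, so is every entry of
every piece at the points of the record space of ITS domain. [cite: Balaban1987RG1, p.263 («defined and analytic on the space U^c_j(X, α₀, α₁)»), (1.11)–(1.16) p.262] -/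
theorem p0cPiece_analyticAt {α₀ α₁ : ℝ}
    (hT : ∀ (X : (recordDomSys F Mc k K).Dom) (φ : Sect2.CPair (F.P K) (MatA 2)), encodeCfg F K φ ∈ recordUc F Mc k α₀ α₁ K X →
      ∀ i j : FluctIdx F k K, AnalyticAt ℂ (fun ψ : Sect2.CPair (F.P K) (MatA 2) => T X ψ i j) φ)
    (Y : (recordDomSys F Mc k K).Dom) (φ : Sect2.CPair (F.P K) (MatA 2)) (hφ : encodeCfg F K φ ∈ recordUc F Mc k α₀ α₁ K Y) (i j : FluctIdx F k K) :
    AnalyticAt ℂ (fun ψ : Sect2.CPair (F.P K) (MatA 2) => p0cPiece F Mc k K T Y ψ i j) φ := by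
  let p : (recordDomSys F Mc k K).Dom → (Sect2.CPair (F.P K) (MatA 2) → FluctIdx F k K → FluctIdx F k K → ℂ) → Prop :=
    fun Y m => ∀ φ, encodeCfg F K φ ∈ recordUc F Mc k α₀ α₁ K Y → ∀ i j, AnalyticAt ℂ (fun ψ : Sect2.CPair (F.P K) (MatA 2) => m ψ i j) φ
  have key : ∀ Y, p Y (p0cPiece F Mc k K T Y) := by
    refine (p0cDown F Mc k K).mobius_induction p ?_ ?_ ?_ ?_ hT
    · intro Y Y' m hss hm φ hφ i j
      exact hm φ (recordUc_antitone F hss.subset hφ) i j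
    · intro Y φ _ i j; exact analyticAt_const
    · intro Y a b ha hb φ hφ i j; exact (ha φ hφ i j).add (hb φ hφ i j)
    · intro Y a b ha hb φ hφ i j; exact (ha φ hφ i j).sub (hb φ hφ i j)
  exact key Y φ hφ i j

/-- **(P3) TRANSFERS**: blockwise covariance under the (1.10) action through a fixed conjugation `AdM u` passes from the family to every piece (conjugation is linear).
[cite: Balaban1987RG1, (1.10) p.262, (1.19) p.263] -/
theorem p0cPiece_cAct (AdM : (Site (F.P K) 0 → (MatA 2)ˣ) → Matrix (FluctIdx F k K) (FluctIdx F k K) ℂ)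
    (hT : ∀ (X : (recordDomSys F Mc k K).Dom) (u : Site (F.P K) 0 → (MatA 2)ˣ) (φ : Sect2.CPair (F.P K) (MatA 2)),
      Matrix.of (T X (Sect2.cAct u φ)) = AdM u * Matrix.of (T X φ) * (AdM u)⁻¹)
    (Y : (recordDomSys F Mc k K).Dom) (u : Site (F.P K) 0 → (MatA 2)ˣ) (φ : Sect2.CPair (F.P K) (MatA 2)) :
    Matrix.of (p0cPiece F Mc k K T Y (Sect2.cAct u φ)) = AdM u * Matrix.of (p0cPiece F Mc k K T Y φ) * (AdM u)⁻¹ := by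
  let p : (recordDomSys F Mc k K).Dom → (Sect2.CPair (F.P K) (MatA 2) → FluctIdx F k K → FluctIdx F k K → ℂ) → Prop :=
    fun _ m => ∀ u φ, Matrix.of (m (Sect2.cAct u φ)) = AdM u * Matrix.of (m φ) * (AdM u)⁻¹
  have key : ∀ Y, p Y (p0cPiece F Mc k K T Y) := by
    refine (p0cDown F Mc k K).mobius_induction p (fun _ _ _ _ h => h) ?_ ?_ ?_ hT
    · intro Y u φ
      have h0 : Matrix.of ((0 : Sect2.CPair (F.P K) (MatA 2) → FluctIdx F k K → FluctIdx F k K → ℂ) φ) = 0 := rfl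
      have h0' : Matrix.of ((0 : Sect2.CPair (F.P K) (MatA 2) → FluctIdx F k K → FluctIdx F k K → ℂ) (Sect2.cAct u φ)) = 0 := rfl
      rw [h0, h0', Matrix.mul_zero, Matrix.zero_mul]
    · intro Y a b ha hb u φ
      have e1 : Matrix.of ((a + b) (Sect2.cAct u φ)) = Matrix.of (a (Sect2.cAct u φ)) + Matrix.of (b (Sect2.cAct u φ)) := rfl
      have e2 : Matrix.of ((a + b) φ) = Matrix.of (a φ) + Matrix.of (b φ) := rfl
      rw [e1, e2, ha u φ, hb u φ, Matrix.mul_add, Matrix.add_mul]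
    · intro Y a b ha hb u φ
      have e1 : Matrix.of ((a - b) (Sect2.cAct u φ)) = Matrix.of (a (Sect2.cAct u φ)) - Matrix.of (b (Sect2.cAct u φ)) := rfl
      have e2 : Matrix.of ((a - b) φ) = Matrix.of (a φ) - Matrix.of (b φ) := rfl
      rw [e1, e2, ha u φ, hb u φ, Matrix.mul_sub, Matrix.sub_mul]
  exact key Y u φ

end Record

end Summit.QuantumFields.YangMills.Theorems.BalabanUVNodesPortS1

end
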